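import Summits.QuantumFields.YangMills.Theorems.BalabanUVNodesN15TwoSpacingGluingRecordKnitRightNonlocal
import Summits.QuantumFields.YangMills.Theorems.BalabanUVNodesN15NeumannCubeLiftRightEntriesForward
import Summits.QuantumFields.YangMills.Theorems.BalabanUVNodesN15TwoSpacingGluingNeumannKnitRightDefect
import HarnessLib

/-!
# THE GLUING STEP AT TWO LATTICE SPACINGS, LXV: THE TWO-GRID η-DEFECT OF THE RECORD COVER's ADJOINT REMAINDER `𝔇(R̃′, R̃)`, HYPOTHESIS-FREE, VOLUME FREE
# (dag-n15-c g14, FILE 108; N15 = NE2, s1 «background-layer OPERATOR ingredient»)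

Cell `pub-ymgap`, seat `pub-ymgap-dag-n15-c` (R134 (a); HUMAN RULING D-0062), generation 14.  `bears_on: R4∕N15 · K3⁸ SpineGivenEndpointR13SepCoPHV (stmt-QuantumFields-27366)`.
Filed `--supports stmt-QuantumFields-27366 --as helper` — COUNT-NEUTRAL.  Theorems only (0 `def`, 0 `sorry`).  Imports BY NAME FILE 107 `…RecordKnitRightNonlocal` (★★★
`hasMaj_idef_chiCube_knitGR_comp_commOp_nonlocal`; through it FILE 105 `hasMaj_idef_cut_comp_commOp_deltaOp_of_sandwich`, FILE 104∕103 (`hasMaj_chiCube_knitGR_comp_commOp_deltaOp_pair`), FILE 102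
supports, FILE 94 `remainderL_cut`, FILE 57 `hasMaj_idef_remainderL_out`, FILE 65 `hcube_cut`, FILE 67 `abs_coverH_le_one` ∕ `abs_coverH_fine_sub_le`, FILE 72 `chiCube_coverCorner_eq_one_side` ∕
`sum_ind_cubeBlocks_le_overlap`, FILE 73 `knitGR` ∕ `knitHR` ∕ `MP_eq_two_mul` ∕ `coverMargin_fit`, programme P: P-IId `hasMaj_chiCube_liftCubeG_fine`, P-IIj `chiCube_liftCubeG_comp_divAdj_mulOp` ∕
`hasMaj_transplant_gDivAdj_pair` ∕ `hasMaj_idef_transplant_gDivAdj`, P-IIc `hasMaj_idef_chiCube_liftCubeG`, `idef_neg_neg`), FILE 106 `…NeumannCubeLiftRightEntriesForward` (`chiCube_liftCubeG_comp_sD_mulOp_transplant`,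
`hasMaj_transplant_gGrad_pair`, `hasMaj_idef_transplant_gGrad`) and FILE 98 `…NeumannKnitRightDefect` (`rightDefectConst_le`, `maj₁_weaken`); nothing in the tree is modified.

WHAT.  ★★★ **`hasMaj_idef_remainderLR_knit`** — the record twin of FILE 98 `hasMaj_idef_remainderL_knit`: for odd `L ≥ 3`, `a > 0` there are `δ, γ > 0`, `rr ≥ 0` with, for all `s`, `m_T ≥ s + 1`,
`K ≥ 1` (`4 ≤ L^K`), `r`, on the torus of record `MP (paramsOf d L m_T K hL)` with FILE 73's cover (lifted cubes `knitGR` of side `L^{s+1}`, partition `knitHR`) at both spacings (King's pairing):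
  `𝔇(R̃′, R̃) = 𝔇(remainderL Δ′_a h′ G′, remainderL Δ_a h G) ≤ rr·(L^K)^{−γ}·e^{−δ|y−y′|_T}`,
`δ, rr, γ` free of `s`, of the volume `m_T`, of `K` and of `r` — row 14 of FILE 50's bundle ON THE TORUS OF RECORD.  Per cube: FILE 105 §1 with the sandwiches `T⁺_μ := transplant W e
(Sym′∘(G′∘∇′_μ)∘M_{χ′})` (FILE 106's forward slip, identity `chiCube_liftCubeG_comp_sD_mulOp_transplant`) and `T⁻_μ := −transplant W e (Sym′∘(G′∘∇*′_μ)∘M_{χ′})` (P-IIj), their rows (FILE 106 §2 ∕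
P-IIj), their two-grid defects (FILE 106 §3 = N-IIr lifted ∕ P-IIj = N-IIg lifted), P-IId's fine cut row, P-IIc's cut-cube defect and FILE 107's nonlocal defect; FILE 103's coarse cube rows;
summed over the cover by FILE 57 `hasMaj_idef_remainderL_out` with the TRUE overlap `(L+1)^{d+1}`, `|h′| ≤ 1` and FILE 67's fit; the cut invisible at both spacings (FILE 94 `remainderL_cut`); the
rate factors `(L^K)^{−1∕16}`, `(L^K)^{−1∕(8(d+1))}`, `(L^K)^{−γ_N}`, `(L^K·L^s)^{−1}` dominated by `(L^K)^{−γ}` (FILE 98 `rightDefectConst_le`), `1∕L^s ≤ 1`.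

HONEST FRAMING ∕ LIMITS.  Block-majorant bookkeeping over LANDED rows; `U ≡ 1` MODEL of [B6] §2's machine on the torus of record (cube letters from each cube's own doubled torus via programme
P: not circular in the volume); constants crude and ours; nothing of [B5]∕[B6] (2.38)–(2.40)∕[B9] Thm 3.1, 3.14 asserted ([B9] Thm 3.14 = difference TEMPLATE).  NE2⁺ NOT PRINTED, NOT proved;
N15 NOT discharged; counts of record UNMOVED (typed 28∕28 · discharged 5∕27); one finite 𝕋⁴ at fixed ε per index — NOT infinite volume, NOT OS on ℝ⁴, NOT a mass gap, NOT Clay; R4 closes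
`BalabanLadder.UV` only.  Restate-immune (no Theses import).
-/

noncomputable section

namespace Summit.QuantumFields.YangMills.BalabanUVNodes.N15.Gluing

open Literature.MathematicalPhysics.QuantumFieldTheory.Balaban1983to89
open Literature.MathematicalPhysics.QuantumFieldTheory.Balaban1983to89.B5Prop11Plancherel (Tor fine unitVec)
open Literature.MathematicalPhysics.QuantumFieldTheory.Balaban1983to89.B11SectG (BlockNorm HasMaj)
open Literature.MathematicalPhysics.QuantumFieldTheory.Balaban1983to89.B6Prop26Gluing (mulOp ind ind_nonneg ind_le_one)
open Literature.MathematicalPhysics.QuantumFieldTheory.Balaban1983to89.B6Prop26ReachTransplant (transplant)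
open Literature.MathematicalPhysics.QuantumFieldTheory.Balaban1983to89.T4EtaRateDefect (idef)
open Literature.MathematicalPhysics.QuantumFieldTheory.Balaban1983to89.T4EtaRateCoeffDefect (pull)
open Literature.MathematicalPhysics.QuantumFieldTheory.Balaban1983to89.B6UnitTorusCarrier (unitTorusGeo)
open Literature.MathematicalPhysics.QuantumFieldTheory.Balaban1983to89.B5SiteBridgeP12 (MP)
open Literature.MathematicalPhysics.QuantumFieldTheory.King1986.Torus (blockOf tdistT tdistT_nonneg)
open Summit.QuantumFields.YangMills.BalabanUVNodes.N15.VectorPiece (bshiftEquiv kingPrV blkFine)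
open Summit.QuantumFields.YangMills.BalabanUVNodes.N15.BackgroundLayer (fgrad fgradAdj bgrad symbOp_sD_eq symbOp_sTinv_sub_one_eq bgrad_eq_neg_fgradAdj)
open Summit.QuantumFields.YangMills.BalabanUVNodes.N15.TwoGrid (paramsOf deltaOp gOp symOp symbOp sD sTinv chiCube cubeBlocks landauRe qvRe qvAdjRe MP_dvd_MP liftCubeG cubeW redBond torRed
  mem_cubeW hasMaj_chiCube_liftCubeG_fine hasMaj_idef_chiCube_liftCubeG chiCube_liftCubeG_comp_divAdj_mulOp hasMaj_transplant_gDivAdj_pair hasMaj_idef_transplant_gDivAdj idef_neg_neg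
  chiCube_liftCubeG_comp_sD_mulOp_transplant hasMaj_transplant_gGrad_pair hasMaj_idef_transplant_gGrad)

variable {d : ℕ}

/-! ## ★★★ The η-defect of the record cover's `R̃`, hypothesis-free, volume free -/

section Knit

open Real

variable {L : ℕ} [NeZero L]

/-- ★★★ **THE TWO-GRID η-DEFECT OF THE RECORD COVER's ADJOINT REMAINDER, HYPOTHESIS-FREE, VOLUME FREE.**  For odd `L ≥ 3`, `a > 0` there are `δ, γ > 0`, `rr ≥ 0` with, for all `s`,
`m_T ≥ s + 1`, `K ≥ 1` (`4 ≤ L^K`), `r`, on `MP (paramsOf d L m_T K hL)` with FILE 73's cover (`knitGR`: LIFTED Neumann cubes of side `L^{s+1}`; `knitHR`) at both spacings (King's pairing):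
  `𝔇(R̃′, R̃) = 𝔇(remainderL Δ′_a h′ G′, remainderL Δ_a h G) ≤ rr·(L^K)^{−γ}·e^{−δ|y−y′|_T}`,
`δ, rr, γ` free of `s, m_T, K, r`.  Per cube FILE 105 §1 (sandwiches `T⁺ :=` FILE 106's forward transplant, `T⁻ :=` −P-IIj's backward transplant; rows FILE 106 §2 ∕ P-IIj; defects FILE 106 §3 ∕
P-IIj; P-IId's fine cut row; P-IIc's cube defect; FILE 107's nonlocal defect) and FILE 103's coarse rows, summed by FILE 57 `hasMaj_idef_remainderL_out` (true overlap `(L+1)^{d+1}`, `|h′| ≤ 1`,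
FILE 67's fit), the cut invisible (FILE 94 `remainderL_cut`); the rate factors are dominated by `(L^K)^{−γ}`, `γ = min(1∕16, 1∕(8(d+1)), 1, γ_N)` (FILE 98 `rightDefectConst_le`).
[cite: Balaban1984PropagatorsII, (2.91)–(2.93) p.239, (2.133)–(2.136) p.247 (shapes + mechanism, transposed); Balaban1985BackgroundPropagators, Thm 3.14 pp.426–427 (difference template); King1986,
Prop. 3.9 (3.73) p.665 (rate factor)] -/
theorem hasMaj_idef_remainderLR_knit (hL : Odd L ∧ 1 < L) {a : ℝ} (ha : 0 < a) :
    ∃ δ rr γ : ℝ, 0 < δ ∧ 0 ≤ rr ∧ 0 < γ ∧ ∀ (s mT K r : ℕ) (hs : s + 1 ≤ mT) (_hK : 1 ≤ K) (_hn4 : 4 ≤ L ^ K),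
      HasMaj (BlockNorm.ofBlocks (unitTorusGeo L K (MP (paramsOf d L mT K hL)))
          (fun b : Tor (fine (L ^ K) (MP (paramsOf d L mT K hL))) × Fin (d + 1) => blockOf (L ^ K) (MP (paramsOf d L mT K hL)) b.1))
        (BlockNorm.ofBlocks (unitTorusGeo L K (MP (paramsOf d L mT K hL)))
          (fun x : Tor (fine (L ^ r * L ^ K) (MP (paramsOf d L mT K hL))) × Fin (d + 1) => blockOf (L ^ r * L ^ K) (MP (paramsOf d L mT K hL)) x.1))
        (idef (pull (kingPrV L K r (MP (paramsOf d L mT K hL)))) (pull (kingPrV L K r (MP (paramsOf d L mT K hL))))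
          (remainderL (deltaOp (MP (paramsOf d L mT K hL)) (L ^ r * L ^ K) a) (knitHR d L s mT K (L ^ r * L ^ K) hL) (knitGR d L s mT K (L ^ r * L ^ K) hL hs a))
          (remainderL (deltaOp (MP (paramsOf d L mT K hL)) (L ^ K) a) (knitHR d L s mT K (L ^ K) hL) (knitGR d L s mT K (L ^ K) hL hs a)))
        (fun y y' => rr * ((L : ℝ) ^ K) ^ (-γ) * Real.exp (-(δ * tdistT (MP (paramsOf d L mT K hL)) y y'))) := by
  have hL3 : 3 ≤ L := by obtain ⟨⟨j, hj⟩, h1⟩ := hL; omega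
  have hLpos : 0 < L := by omega
  have hL1 : 1 ≤ L := hLpos
  have hLodd : Odd L := hL.1
  have hL2 : 2 ≤ L := hL.2
  -- programme P's letters (fine cut row, lifted entry rows ∕ defects, cut-cube defect), FILE 106's forward ones, FILE 107's nonlocal defect, FILE 103's coarse rows
  obtain ⟨δ₀, C, hδ₀, hC, HG'⟩ := hasMaj_chiCube_liftCubeG_fine (d := d) hL ha
  obtain ⟨δp, βp, hδp, hβp, HP⟩ := hasMaj_transplant_gGrad_pair (d := d) hL ha
  obtain ⟨δb, βb, hδb, hβb, HB⟩ := hasMaj_transplant_gDivAdj_pair (d := d) hL ha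
  obtain ⟨δc, mc, hδc, hmc, HC⟩ := hasMaj_idef_chiCube_liftCubeG (d := d) hLodd hL2 ha (γ := 1 / 8) (by norm_num) (by norm_num)
  obtain ⟨δib, mb, hδib, hmb, HIB⟩ := hasMaj_idef_transplant_gDivAdj (d := d) hLodd hL2 ha
  obtain ⟨δip, mp, hδip, hmp, HIP⟩ := hasMaj_idef_transplant_gGrad (d := d) hLodd hL2 ha
  obtain ⟨δN, rN, γN, hδN, hrN, hγN, HN⟩ := hasMaj_idef_chiCube_knitGR_comp_commOp_nonlocal (d := d) hL ha
  obtain ⟨δK, Θ₀, hδK, hΘ₀, HK⟩ := hasMaj_chiCube_knitGR_comp_commOp_deltaOp_pair (d := d) hL ha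
  -- one rate for the cube data, one constant for the right entries and their defects
  obtain ⟨δx, hδx_def⟩ : ∃ δx : ℝ, δx = min (min (min δ₀ δp) (min δb δc)) (min δib δip) := ⟨_, rfl⟩
  have hδx : 0 < δx := hδx_def ▸ lt_min (lt_min (lt_min hδ₀ hδp) (lt_min hδb hδc)) (lt_min hδib hδip)
  have dδ0 : δx ≤ δ₀ := hδx_def ▸ (min_le_left _ _).trans ((min_le_left _ _).trans (min_le_left _ _))
  have dδp : δx ≤ δp := hδx_def ▸ (min_le_left _ _).trans ((min_le_left _ _).trans (min_le_right _ _))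
  have dδb : δx ≤ δb := hδx_def ▸ (min_le_left _ _).trans ((min_le_right _ _).trans (min_le_left _ _))
  have dδc : δx ≤ δc := hδx_def ▸ (min_le_left _ _).trans ((min_le_right _ _).trans (min_le_right _ _))
  have dδib : δx ≤ δib := hδx_def ▸ (min_le_right _ _).trans (min_le_left _ _)
  have dδip : δx ≤ δip := hδx_def ▸ (min_le_right _ _).trans (min_le_right _ _)
  have hβx : 0 ≤ βp + βb := by positivity
  have hmx : 0 ≤ mp + mb := by positivity
  have hβp' : βp ≤ βp + βb := by linarith [hβb.le]
  have hβb' : βb ≤ βp + βb := by linarith [hβp.le]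
  have hmp' : mp ≤ mp + mb := by linarith [hmb.le]
  have hmb' : mb ≤ mp + mb := by linarith [hmp.le]
  obtain ⟨ρ, hρ_def⟩ : ∃ ρ : ℝ, ρ = min (min δx δK) δN := ⟨_, rfl⟩
  have hρ : 0 < ρ := hρ_def ▸ lt_min (lt_min hδx hδK) hδN
  have hρx : ρ ≤ δx := hρ_def ▸ (min_le_left _ _).trans (min_le_left _ _)
  have hρK : ρ ≤ δK := hρ_def ▸ (min_le_left _ _).trans (min_le_right _ _)
  have hρN : ρ ≤ δN := hρ_def ▸ min_le_right _ _
  obtain ⟨γ, hγ_def⟩ : ∃ γ : ℝ, γ = min (min (1 / 8 / 2) (1 / (8 * ((d : ℝ) + 1)))) (min 1 γN) := ⟨_, rfl⟩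
  have hγ : 0 < γ := hγ_def ▸ lt_min (lt_min (by norm_num) (by positivity)) (lt_min one_pos hγN)
  have hγ16 : γ ≤ 1 / 8 / 2 := hγ_def ▸ (min_le_left _ _).trans (min_le_left _ _)
  have hγ8 : γ ≤ 1 / (8 * ((d : ℝ) + 1)) := hγ_def ▸ (min_le_left _ _).trans (min_le_right _ _)
  have hγ1 : γ ≤ 1 := hγ_def ▸ (min_le_right _ _).trans (min_le_left _ _)
  have hγN' : γ ≤ γN := hγ_def ▸ (min_le_right _ _).trans (min_le_right _ _)
  have hNov : (0 : ℝ) ≤ (((L + 1) ^ (d + 1) : ℕ) : ℝ) := by positivity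
  refine ⟨ρ, (((L + 1) ^ (d + 1) : ℕ) : ℝ) * (((Fintype.card (Fin (d + 1)) : ℝ) * (3 * (C * (144 * π ^ 3 + 32 * π ^ 3 * Fintype.card (Fin (d + 1))) + mc * (32 * π ^ 2)) + 2 * ((βp + βb) * (64 * π ^ 2 + π ^ 2 * Fintype.card (Fin (d + 1))) + (mp + mb) * π)) + rN) + π * (d + 1) * Θ₀),
    γ, hρ, by positivity, hγ, fun s mT K r hs hK hn4 => ?_⟩
  -- the index's data
  have hs' : s ≤ mT := by omega
  have hM : ∀ ν, MP (paramsOf d L mT K hL) ν = 2 * L ^ (mT - s) * L ^ s := MP_eq_two_mul L s mT K hL hs'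
  have hM2 : ∀ ν, MP (paramsOf d L (s + 1) K hL) ν = 2 * L ^ (s + 1) := fun ν => rfl
  have hw : 0 < L ^ s := pow_pos hLpos s
  have hn : 1 ≤ L ^ K := Nat.one_le_pow _ _ hLpos
  have hn' : 1 ≤ L ^ r * L ^ K := Nat.one_le_iff_ne_zero.mpr (Nat.mul_ne_zero (pow_ne_zero r (NeZero.ne L)) (pow_ne_zero K (NeZero.ne L)))
  have hfit := coverMargin_fit hL3 s
  have hSe : L ^ (s + 1) = L * L ^ s := by rw [pow_succ, mul_comm]
  have hfit1 : coverMargin L s + 2 * L ^ s + 1 ≤ L ^ (s + 1) := by rw [hSe]; omega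
  have hS : L ^ (s + 1) ≤ 2 * L ^ (mT - s) * L ^ s := by
    calc L ^ (s + 1) ≤ L ^ mT := Nat.pow_le_pow_right hLpos hs
      _ = L ^ (mT - s) * L ^ s := by rw [← pow_add]; congr 1; omega
      _ ≤ 2 * L ^ (mT - s) * L ^ s := by rw [mul_assoc]; omega
  have h3 : 3 ≤ L ^ K * L ^ s :=
    calc 3 ≤ L := hL3
      _ = L ^ 1 := (pow_one L).symm
      _ ≤ L ^ K := Nat.pow_le_pow_right hLpos hK
      _ ≤ L ^ K * L ^ s := Nat.le_mul_of_pos_right _ hw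
  have hdiv : L ^ (s + 1) / L ^ s + 1 = L + 1 := by rw [hSe, Nat.mul_div_cancel _ hw]
  have hwR : (1 : ℝ) ≤ ((L ^ s : ℕ) : ℝ) := by exact_mod_cast hw
  have hwcast : ((L ^ s : ℕ) : ℝ) = (L : ℝ) ^ s := Nat.cast_pow L s
  have hxs : (0 : ℝ) < (L : ℝ) ^ s := by rw [← hwcast]; positivity
  have hθK : 0 ≤ Θ₀ / (L : ℝ) ^ s := div_nonneg hΘ₀ hxs.le
  have hθK' : Θ₀ / (L : ℝ) ^ s ≤ Θ₀ := div_le_self hΘ₀ (by rw [← hwcast]; exact hwR)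
  have hx : (1 : ℝ) ≤ (L : ℝ) ^ K := one_le_pow₀ (by exact_mod_cast hL1)
  have hxcast : ((L ^ K : ℕ) : ℝ) = (L : ℝ) ^ K := Nat.cast_pow L K
  -- the rate factors at the index, dominated by `θ = (L^K)^{−γ}`
  have hθ0 : 0 ≤ ((L : ℝ) ^ K) ^ (-γ) := Real.rpow_nonneg (zero_le_one.trans hx) _
  have he16 : 0 ≤ ((L ^ K : ℕ) : ℝ) ^ (-(1 / 8 / 2 : ℝ)) := Real.rpow_nonneg (Nat.cast_nonneg _) _
  have he16' : ((L ^ K : ℕ) : ℝ) ^ (-(1 / 8 / 2 : ℝ)) ≤ ((L : ℝ) ^ K) ^ (-γ) := by rw [hxcast]; exact Real.rpow_le_rpow_of_exponent_le hx (neg_le_neg hγ16)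
  have he8 : 0 ≤ ((L ^ K : ℕ) : ℝ) ^ (-(1 / (8 * ((d : ℝ) + 1)))) := Real.rpow_nonneg (Nat.cast_nonneg _) _
  have he8' : ((L ^ K : ℕ) : ℝ) ^ (-(1 / (8 * ((d : ℝ) + 1)))) ≤ ((L : ℝ) ^ K) ^ (-γ) := by rw [hxcast]; exact Real.rpow_le_rpow_of_exponent_le hx (neg_le_neg hγ8)
  have heN' : ((L : ℝ) ^ K) ^ (-γN) ≤ ((L : ℝ) ^ K) ^ (-γ) := Real.rpow_le_rpow_of_exponent_le hx (neg_le_neg hγN')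
  have heN : 0 ≤ ((L : ℝ) ^ K) ^ (-γN) := Real.rpow_nonneg (zero_le_one.trans hx) _
  have hε₁0 : 0 ≤ (((L ^ K : ℕ) : ℝ) * ((L ^ s : ℕ) : ℝ))⁻¹ := by positivity
  have hε₁ : (((L ^ K : ℕ) : ℝ) * ((L ^ s : ℕ) : ℝ))⁻¹ ≤ ((L : ℝ) ^ K) ^ (-γ) := by
    calc (((L ^ K : ℕ) : ℝ) * ((L ^ s : ℕ) : ℝ))⁻¹ ≤ (((L ^ K : ℕ) : ℝ))⁻¹ := by
          rw [mul_inv]; exact mul_le_of_le_one_right (by positivity) (inv_le_one_of_one_le₀ hwR)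
      _ = ((L : ℝ) ^ K) ^ (-(1 : ℝ)) := by rw [hxcast, Real.rpow_neg_one]
      _ ≤ ((L : ℝ) ^ K) ^ (-γ) := Real.rpow_le_rpow_of_exponent_le hx (neg_le_neg hγ1)
  -- per cube: FILE 103's coarse row and FILE 105's defect fed with programme P ∕ FILE 106 ∕ FILE 107
  have hblk : (fun x : Tor (fine (L ^ r * L ^ K) (MP (paramsOf d L mT K hL))) × Fin (d + 1) => blockOf (L ^ r * L ^ K) (MP (paramsOf d L mT K hL)) x.1) =
      (fun b : Tor (fine (L ^ K) (MP (paramsOf d L mT K hL))) × Fin (d + 1) => blockOf (L ^ K) (MP (paramsOf d L mT K hL)) b.1) ∘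
        kingPrV L K r (MP (paramsOf d L mT K hL)) := (VectorPiece.blkFine_comp_kingPrV (M := MP (paramsOf d L mT K hL)) L K r).symm
  have hKD : ∀ k : Fin (d + 1) → ZMod (2 * L ^ (mT - s)),
      HasMaj (BlockNorm.ofBlocks (unitTorusGeo L K (MP (paramsOf d L mT K hL)))
          (fun b : Tor (fine (L ^ K) (MP (paramsOf d L mT K hL))) × Fin (d + 1) => blockOf (L ^ K) (MP (paramsOf d L mT K hL)) b.1))
        (BlockNorm.ofBlocks (unitTorusGeo L K (MP (paramsOf d L mT K hL)))
          (fun b : Tor (fine (L ^ K) (MP (paramsOf d L mT K hL))) × Fin (d + 1) => blockOf (L ^ K) (MP (paramsOf d L mT K hL)) b.1))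
        ((mulOp (chiCube (MP (paramsOf d L mT K hL)) (L ^ K) (coverCorner (MP (paramsOf d L mT K hL)) (L ^ s) (L ^ (mT - s)) (coverMargin L s) k) (L ^ (s + 1))) ∘ₗ
          knitGR d L s mT K (L ^ K) hL hs a k) ∘ₗ commOp (deltaOp (MP (paramsOf d L mT K hL)) (L ^ K) a) (knitHR d L s mT K (L ^ K) hL k))
        (fun y y' => ind ((cubeBlocks (MP (paramsOf d L mT K hL)) (coverCorner (MP (paramsOf d L mT K hL)) (L ^ s) (L ^ (mT - s)) (coverMargin L s) k) (L ^ (s + 1)) : Finset _) : Set _) y *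
          (Θ₀ / (L : ℝ) ^ s * Real.exp (-(ρ * tdistT (MP (paramsOf d L mT K hL)) y y')))) ∧
      HasMaj (BlockNorm.ofBlocks (unitTorusGeo L K (MP (paramsOf d L mT K hL)))
          (fun b : Tor (fine (L ^ K) (MP (paramsOf d L mT K hL))) × Fin (d + 1) => blockOf (L ^ K) (MP (paramsOf d L mT K hL)) b.1))
        (BlockNorm.ofBlocks (unitTorusGeo L K (MP (paramsOf d L mT K hL)))
          (fun x : Tor (fine (L ^ r * L ^ K) (MP (paramsOf d L mT K hL))) × Fin (d + 1) => blockOf (L ^ r * L ^ K) (MP (paramsOf d L mT K hL)) x.1))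
        (idef (pull (kingPrV L K r (MP (paramsOf d L mT K hL)))) (pull (kingPrV L K r (MP (paramsOf d L mT K hL))))
          ((mulOp (chiCube (MP (paramsOf d L mT K hL)) (L ^ r * L ^ K) (coverCorner (MP (paramsOf d L mT K hL)) (L ^ s) (L ^ (mT - s)) (coverMargin L s) k) (L ^ (s + 1))) ∘ₗ
              knitGR d L s mT K (L ^ r * L ^ K) hL hs a k) ∘ₗ commOp (deltaOp (MP (paramsOf d L mT K hL)) (L ^ r * L ^ K) a) (knitHR d L s mT K (L ^ r * L ^ K) hL k))
          ((mulOp (chiCube (MP (paramsOf d L mT K hL)) (L ^ K) (coverCorner (MP (paramsOf d L mT K hL)) (L ^ s) (L ^ (mT - s)) (coverMargin L s) k) (L ^ (s + 1))) ∘ₗ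
              knitGR d L s mT K (L ^ K) hL hs a k) ∘ₗ commOp (deltaOp (MP (paramsOf d L mT K hL)) (L ^ K) a) (knitHR d L s mT K (L ^ K) hL k)))
        (fun y y' => ind ((cubeBlocks (MP (paramsOf d L mT K hL)) (coverCorner (MP (paramsOf d L mT K hL)) (L ^ s) (L ^ (mT - s)) (coverMargin L s) k) (L ^ (s + 1)) : Finset _) : Set _) y *
          (((Fintype.card (Fin (d + 1)) : ℝ) * (3 * (C *
              (((((L ^ s : ℕ) : ℝ)))⁻¹ ^ 2 * (((L ^ K : ℕ) : ℝ) * ((L ^ s : ℕ) : ℝ))⁻¹ * (144 * π ^ 3 + 32 * π ^ 3 * Fintype.card (Fin (d + 1)))) +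
                mc * ((L ^ K : ℕ) : ℝ) ^ (-(1 / 8 / 2 : ℝ)) * (32 * π ^ 2 / ((L ^ s : ℕ) : ℝ) ^ 2)) +
              2 * ((βp + βb) * (|((((L ^ s : ℕ) : ℝ)))⁻¹| * (((L ^ K : ℕ) : ℝ) * ((L ^ s : ℕ) : ℝ))⁻¹ * (64 * π ^ 2 + π ^ 2 * Fintype.card (Fin (d + 1)))) +
                (mp + mb) * ((L ^ K : ℕ) : ℝ) ^ (-(1 / (8 * ((d : ℝ) + 1)))) * (π / ((L ^ s : ℕ) : ℝ)))) + 0 + rN * ((L : ℝ) ^ K) ^ (-γN)) *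
            Real.exp (-(ρ * tdistT (MP (paramsOf d L mT K hL)) y y')))) := fun k => by
    -- the coarse row (FILE 103)
    have hKr := ((HK s mT K r hs hK k).1).mono fun y y' => maj₁_weaken le_rfl hθK hρK y y'
    -- supports of the partition's shifted coefficients one step inside the cube (FILE 102)
    have hgD : ∀ (n : ℕ) [NeZero n] (μ : Fin (d + 1)) (b : Tor (fine n (MP (paramsOf d L mT K hL))) × Fin (d + 1)),
        (fgrad (n : ℝ) (bshiftEquiv (MP (paramsOf d L mT K hL)) n μ) (hcube (2 * L ^ (mT - s)) (coverXi (MP (paramsOf d L mT K hL)) n (L ^ s)) k) ∘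
          ⇑(bshiftEquiv (MP (paramsOf d L mT K hL)) n μ).symm) b ≠ 0 →
        b ∈ cubeW n (coverCorner (MP (paramsOf d L mT K hL)) (L ^ s) (L ^ (mT - s)) (coverMargin L s) k) (L ^ (s + 1)) ∧
          (b.1 - unitVec (fine n (MP (paramsOf d L mT K hL))) μ, b.2) ∈ cubeW n (coverCorner (MP (paramsOf d L mT K hL)) (L ^ s) (L ^ (mT - s)) (coverMargin L s) k) (L ^ (s + 1)) :=
      fun n _ μ b hb => by
      have h := bgrad_coverH_support_side (m₀ := coverMargin L s) hM hw hfit1 hS μ k b hb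
      exact ⟨(mem_cubeW b).mpr h.1, (mem_cubeW _).mpr h.2⟩
    have hgB : ∀ (n : ℕ) [NeZero n] (μ : Fin (d + 1)) (b : Tor (fine n (MP (paramsOf d L mT K hL))) × Fin (d + 1)),
        (bgrad (n : ℝ) (bshiftEquiv (MP (paramsOf d L mT K hL)) n μ) (hcube (2 * L ^ (mT - s)) (coverXi (MP (paramsOf d L mT K hL)) n (L ^ s)) k) ∘
          ⇑(bshiftEquiv (MP (paramsOf d L mT K hL)) n μ)) b ≠ 0 →
        b ∈ cubeW n (coverCorner (MP (paramsOf d L mT K hL)) (L ^ s) (L ^ (mT - s)) (coverMargin L s) k) (L ^ (s + 1)) ∧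
          (b.1 + unitVec (fine n (MP (paramsOf d L mT K hL))) μ, b.2) ∈ cubeW n (coverCorner (MP (paramsOf d L mT K hL)) (L ^ s) (L ^ (mT - s)) (coverMargin L s) k) (L ^ (s + 1)) :=
      fun n _ μ b hb => by
      have h := fgrad_coverH_support_side (m₀ := coverMargin L s) hM hw hfit1 hS μ k b hb
      exact ⟨(mem_cubeW b).mpr h.1, (mem_cubeW _).mpr h.2⟩
    -- `(M_χG^{↑})∘∇⁻ = −((M_χG^{↑})∘∇*)` behind any multiplier
    have eB : ∀ (n : ℕ) [NeZero n] (μ : Fin (d + 1)) (c : Tor (fine n (MP (paramsOf d L mT K hL))) × Fin (d + 1) → ℝ),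
        (mulOp (chiCube (MP (paramsOf d L mT K hL)) n (coverCorner (MP (paramsOf d L mT K hL)) (L ^ s) (L ^ (mT - s)) (coverMargin L s) k) (L ^ (s + 1))) ∘ₗ
            knitGR d L s mT K n hL hs a k) ∘ₗ bgrad (n : ℝ) (bshiftEquiv (MP (paramsOf d L mT K hL)) n μ) ∘ₗ mulOp c =
          -((mulOp (chiCube (MP (paramsOf d L mT K hL)) n (coverCorner (MP (paramsOf d L mT K hL)) (L ^ s) (L ^ (mT - s)) (coverMargin L s) k) (L ^ (s + 1))) ∘ₗ
            knitGR d L s mT K n hL hs a k) ∘ₗ fgradAdj (n : ℝ) (bshiftEquiv (MP (paramsOf d L mT K hL)) n μ) ∘ₗ mulOp c) := fun n _ μ c => by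
      rw [bgrad_eq_neg_fgradAdj, LinearMap.neg_comp, LinearMap.comp_neg]
    -- the fine rows, the defects, the nonlocal defect — at the rate `δx` resp. `ρ`
    have hGc' := (HG' (s + 1) mT K r hs hK (coverCorner (MP (paramsOf d L mT K hL)) (L ^ s) (L ^ (mT - s)) (coverMargin L s) k)).mono fun y y' => maj₂_weaken le_rfl hC.le dδ0 y y'
    have hTD' : ∀ μ : Fin (d + 1), _ := fun μ => by
      have h := (HP (s + 1) mT K r hs hK (coverCorner (MP (paramsOf d L mT K hL)) (L ^ s) (L ^ (mT - s)) (coverMargin L s) k) μ).2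
      rw [symbOp_sD_eq] at h
      exact h.mono fun y y' => maj₂_weaken hβp' hβx dδp y y'
    have hTB' : ∀ μ : Fin (d + 1), _ := fun μ => by
      have h := (HB (s + 1) mT K r hs hK (coverCorner (MP (paramsOf d L mT K hL)) (L ^ s) (L ^ (mT - s)) (coverMargin L s) k) μ).2
      rw [symbOp_sTinv_sub_one_eq] at h
      exact h.neg.mono fun y y' => maj₂_weaken hβb' hβx dδb y y'
    have hIG := by
      have h := HC (s + 1) mT K r hK hL hs (coverCorner (MP (paramsOf d L mT K hL)) (L ^ s) (L ^ (mT - s)) (coverMargin L s) k)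
      exact h.mono fun y y' => maj₂_weaken (le_refl (mc * ((L ^ K : ℕ) : ℝ) ^ (-(1 / 8 / 2 : ℝ)))) (mul_nonneg hmc.le he16) dδc y y'
    have hITD : ∀ μ : Fin (d + 1), _ := fun μ => by
      have h := HIP (s + 1) mT K r hK hn4 hL hs (coverCorner (MP (paramsOf d L mT K hL)) (L ^ s) (L ^ (mT - s)) (coverMargin L s) k) μ
      rw [symbOp_sD_eq, symbOp_sD_eq] at h
      exact h.mono fun y y' => maj₂_weaken (mul_le_mul_of_nonneg_right hmp' he8) (mul_nonneg hmx he8) dδip y y'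
    have hITB : ∀ μ : Fin (d + 1), _ := fun μ => by
      have h := HIB (s + 1) mT K r hK hn4 hL hs (coverCorner (MP (paramsOf d L mT K hL)) (L ^ s) (L ^ (mT - s)) (coverMargin L s) k) μ
      rw [symbOp_sTinv_sub_one_eq, symbOp_sTinv_sub_one_eq] at h
      have h2 := h.neg
      rw [← idef_neg_neg] at h2
      exact h2.mono fun y y' => maj₂_weaken (mul_le_mul_of_nonneg_right hmb' he8) (mul_nonneg hmx he8) dδib y y'
    have hDNk := (HN s mT K r hs hK k).mono fun y y' => maj₁_weaken (le_refl (rN * ((L : ℝ) ^ K) ^ (-γN))) (mul_nonneg hrN heN) hρN y y'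
    -- FILE 105 §1 per cube, the sandwiches being FILE 106's forward transplant and minus P-IIj's backward transplant
    have hD := hasMaj_idef_cut_comp_commOp_deltaOp_of_sandwich (L := L) (kk := K) (r := r) (q := L ^ (mT - s)) (w := L ^ s)
      (Gc := knitGR d L s mT K (L ^ K) hL hs a k) (Gc' := knitGR d L s mT K (L ^ r * L ^ K) hL hs a k)
      (TD := fun μ => transplant (cubeW (L ^ K) (coverCorner (MP (paramsOf d L mT K hL)) (L ^ s) (L ^ (mT - s)) (coverMargin L s) k) (L ^ (s + 1))) (redBond (L ^ K) (MP_dvd_MP hL hs K))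
        (symOp (MP (paramsOf d L (s + 1) K hL)) (L ^ K) (torRed (MP_dvd_MP hL hs K) (coverCorner (MP (paramsOf d L mT K hL)) (L ^ s) (L ^ (mT - s)) (coverMargin L s) k)) ∘ₗ
          (gOp (MP (paramsOf d L (s + 1) K hL)) (L ^ K) a ∘ₗ fgrad ((L ^ K : ℕ) : ℝ) (bshiftEquiv (MP (paramsOf d L (s + 1) K hL)) (L ^ K) μ)) ∘ₗ
          mulOp (chiCube (MP (paramsOf d L (s + 1) K hL)) (L ^ K) (torRed (MP_dvd_MP hL hs K) (coverCorner (MP (paramsOf d L mT K hL)) (L ^ s) (L ^ (mT - s)) (coverMargin L s) k)) (L ^ (s + 1)))))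
      (TB := fun μ => -transplant (cubeW (L ^ K) (coverCorner (MP (paramsOf d L mT K hL)) (L ^ s) (L ^ (mT - s)) (coverMargin L s) k) (L ^ (s + 1))) (redBond (L ^ K) (MP_dvd_MP hL hs K))
        (symOp (MP (paramsOf d L (s + 1) K hL)) (L ^ K) (torRed (MP_dvd_MP hL hs K) (coverCorner (MP (paramsOf d L mT K hL)) (L ^ s) (L ^ (mT - s)) (coverMargin L s) k)) ∘ₗ
          (gOp (MP (paramsOf d L (s + 1) K hL)) (L ^ K) a ∘ₗ fgradAdj ((L ^ K : ℕ) : ℝ) (bshiftEquiv (MP (paramsOf d L (s + 1) K hL)) (L ^ K) μ)) ∘ₗ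
          mulOp (chiCube (MP (paramsOf d L (s + 1) K hL)) (L ^ K) (torRed (MP_dvd_MP hL hs K) (coverCorner (MP (paramsOf d L mT K hL)) (L ^ s) (L ^ (mT - s)) (coverMargin L s) k)) (L ^ (s + 1)))))
      (TD' := fun μ => transplant (cubeW (L ^ r * L ^ K) (coverCorner (MP (paramsOf d L mT K hL)) (L ^ s) (L ^ (mT - s)) (coverMargin L s) k) (L ^ (s + 1))) (redBond (L ^ r * L ^ K) (MP_dvd_MP hL hs K))
        (symOp (MP (paramsOf d L (s + 1) K hL)) (L ^ r * L ^ K) (torRed (MP_dvd_MP hL hs K) (coverCorner (MP (paramsOf d L mT K hL)) (L ^ s) (L ^ (mT - s)) (coverMargin L s) k)) ∘ₗ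
          (gOp (MP (paramsOf d L (s + 1) K hL)) (L ^ r * L ^ K) a ∘ₗ fgrad ((L ^ r * L ^ K : ℕ) : ℝ) (bshiftEquiv (MP (paramsOf d L (s + 1) K hL)) (L ^ r * L ^ K) μ)) ∘ₗ
          mulOp (chiCube (MP (paramsOf d L (s + 1) K hL)) (L ^ r * L ^ K) (torRed (MP_dvd_MP hL hs K) (coverCorner (MP (paramsOf d L mT K hL)) (L ^ s) (L ^ (mT - s)) (coverMargin L s) k)) (L ^ (s + 1)))))
      (TB' := fun μ => -transplant (cubeW (L ^ r * L ^ K) (coverCorner (MP (paramsOf d L mT K hL)) (L ^ s) (L ^ (mT - s)) (coverMargin L s) k) (L ^ (s + 1))) (redBond (L ^ r * L ^ K) (MP_dvd_MP hL hs K))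
        (symOp (MP (paramsOf d L (s + 1) K hL)) (L ^ r * L ^ K) (torRed (MP_dvd_MP hL hs K) (coverCorner (MP (paramsOf d L mT K hL)) (L ^ s) (L ^ (mT - s)) (coverMargin L s) k)) ∘ₗ
          (gOp (MP (paramsOf d L (s + 1) K hL)) (L ^ r * L ^ K) a ∘ₗ fgradAdj ((L ^ r * L ^ K : ℕ) : ℝ) (bshiftEquiv (MP (paramsOf d L (s + 1) K hL)) (L ^ r * L ^ K) μ)) ∘ₗ
          mulOp (chiCube (MP (paramsOf d L (s + 1) K hL)) (L ^ r * L ^ K) (torRed (MP_dvd_MP hL hs K) (coverCorner (MP (paramsOf d L mT K hL)) (L ^ s) (L ^ (mT - s)) (coverMargin L s) k)) (L ^ (s + 1)))))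
      hM hw h3 k (coverCorner (MP (paramsOf d L mT K hL)) (L ^ s) (L ^ (mT - s)) (coverMargin L s) k) (L ^ (s + 1)) hC.le hβx (mul_nonneg hmc.le he16) (mul_nonneg hmx he8) hρx
      (fun μ => by
        have h := chiCube_liftCubeG_comp_sD_mulOp_transplant (L ^ K) (MP_dvd_MP hL hs K) (coverCorner (MP (paramsOf d L mT K hL)) (L ^ s) (L ^ (mT - s)) (coverMargin L s) k) (L ^ (s + 1))
          hM2 hn ha μ (hgD (L ^ K) μ)
        rw [symbOp_sD_eq, symbOp_sD_eq] at h
        exact (LinearMap.comp_assoc _ _ _).trans h)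
      (fun μ => by
        have h := chiCube_liftCubeG_comp_divAdj_mulOp (L ^ K) (MP_dvd_MP hL hs K) (coverCorner (MP (paramsOf d L mT K hL)) (L ^ s) (L ^ (mT - s)) (coverMargin L s) k) (L ^ (s + 1))
          hM2 hn ha μ (hgB (L ^ K) μ)
        rw [symbOp_sTinv_sub_one_eq, symbOp_sTinv_sub_one_eq] at h
        exact (eB _ μ _).trans ((congrArg Neg.neg ((LinearMap.comp_assoc _ _ _).trans h)).trans (LinearMap.neg_comp _ _).symm))
      (fun μ => by
        have h := chiCube_liftCubeG_comp_sD_mulOp_transplant (L ^ r * L ^ K) (MP_dvd_MP hL hs K) (coverCorner (MP (paramsOf d L mT K hL)) (L ^ s) (L ^ (mT - s)) (coverMargin L s) k) (L ^ (s + 1))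
          hM2 hn' ha μ (hgD (L ^ r * L ^ K) μ)
        rw [symbOp_sD_eq, symbOp_sD_eq] at h
        exact (LinearMap.comp_assoc _ _ _).trans h)
      (fun μ => by
        have h := chiCube_liftCubeG_comp_divAdj_mulOp (L ^ r * L ^ K) (MP_dvd_MP hL hs K) (coverCorner (MP (paramsOf d L mT K hL)) (L ^ s) (L ^ (mT - s)) (coverMargin L s) k) (L ^ (s + 1))
          hM2 hn' ha μ (hgB (L ^ r * L ^ K) μ)
        rw [symbOp_sTinv_sub_one_eq, symbOp_sTinv_sub_one_eq] at h
        exact (eB _ μ _).trans ((congrArg Neg.neg ((LinearMap.comp_assoc _ _ _).trans h)).trans (LinearMap.neg_comp _ _).symm))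
      hGc' hTD' hTB' hIG hITD hITB hDNk
    exact ⟨hKr, hD⟩
  -- the cut, the overlap, the fit; FILE 57
  have hone := fun (n : ℕ) [NeZero n] (k : Fin (d + 1) → ZMod (2 * L ^ (mT - s))) =>
    chiCube_coverCorner_eq_one_side (M := MP (paramsOf d L mT K hL)) (n := n) (m₀ := coverMargin L s) hM hw hfit1 hS 0 k
  have hcut : ∀ k : Fin (d + 1) → ZMod (2 * L ^ (mT - s)), mulOp (knitHR d L s mT K (L ^ K) hL k) ∘ₗ
      mulOp (chiCube (MP (paramsOf d L mT K hL)) (L ^ K) (coverCorner (MP (paramsOf d L mT K hL)) (L ^ s) (L ^ (mT - s)) (coverMargin L s) k) (L ^ (s + 1))) =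
      mulOp (knitHR d L s mT K (L ^ K) hL k) := fun k =>
    hcube_cut (2 * L ^ (mT - s)) (coverXi (MP (paramsOf d L mT K hL)) (L ^ K) (L ^ s)) (bshiftEquiv (MP (paramsOf d L mT K hL)) (L ^ K)) 0 (hone (L ^ K) k)
  have hcut' : ∀ k : Fin (d + 1) → ZMod (2 * L ^ (mT - s)), mulOp (knitHR d L s mT K (L ^ r * L ^ K) hL k) ∘ₗ
      mulOp (chiCube (MP (paramsOf d L mT K hL)) (L ^ r * L ^ K) (coverCorner (MP (paramsOf d L mT K hL)) (L ^ s) (L ^ (mT - s)) (coverMargin L s) k) (L ^ (s + 1))) =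
      mulOp (knitHR d L s mT K (L ^ r * L ^ K) hL k) := fun k =>
    hcube_cut (2 * L ^ (mT - s)) (coverXi (MP (paramsOf d L mT K hL)) (L ^ r * L ^ K) (L ^ s)) (bshiftEquiv (MP (paramsOf d L mT K hL)) (L ^ r * L ^ K)) 0 (hone (L ^ r * L ^ K) k)
  have hh' : ∀ (k : Fin (d + 1) → ZMod (2 * L ^ (mT - s))) x', |knitHR d L s mT K (L ^ r * L ^ K) hL k x'| ≤ 1 := fun k x' => abs_coverH_le_one k x'
  have hfitH : ∀ (k : Fin (d + 1) → ZMod (2 * L ^ (mT - s))) x', |knitHR d L s mT K (L ^ r * L ^ K) hL k x' - knitHR d L s mT K (L ^ K) hL k (kingPrV L K r (MP (paramsOf d L mT K hL)) x')| ≤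
      π * (d + 1) / (((L ^ K : ℕ) : ℝ) * ((L ^ s : ℕ) : ℝ)) := fun k x' => abs_coverH_fine_sub_le (L := L) (kk := K) (r := r) hM hw k x'
  have hN : ∀ y : Tor (MP (paramsOf d L mT K hL)), ∑ k : Fin (d + 1) → ZMod (2 * L ^ (mT - s)),
      ind (g := unitTorusGeo L K (MP (paramsOf d L mT K hL)))
        ((cubeBlocks (MP (paramsOf d L mT K hL)) (coverCorner (MP (paramsOf d L mT K hL)) (L ^ s) (L ^ (mT - s)) (coverMargin L s) k) (L ^ (s + 1)) : Finset _) : Set _) y ≤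
      (((L + 1) ^ (d + 1) : ℕ) : ℝ) := fun y => by
    have h := sum_ind_cubeBlocks_le_overlap (S := L ^ (s + 1)) (m₀ := coverMargin L s) hM hw L K y
    rw [hdiv] at h
    exact h
  have hΘd := rightDefectConst_le (D := (Fintype.card (Fin (d + 1)) : ℝ)) (β := C) (β₁ := βp + βb) (mc := mc) (mx := mp + mb) (rN := rN)
    (A₁ := 64 * π ^ 2 + π ^ 2 * Fintype.card (Fin (d + 1))) (A₂ := 144 * π ^ 3 + 32 * π ^ 3 * Fintype.card (Fin (d + 1))) (w := ((L ^ s : ℕ) : ℝ)) hwR (by positivity)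
    hC.le hβx hmc.le hmx hrN (by positivity) (by positivity) hε₁0 hε₁ he16 he16' he8 he8' heN'
  have hIR := hasMaj_idef_remainderL_out (g := unitTorusGeo L K (MP (paramsOf d L mT K hL)))
    (fun b : Tor (fine (L ^ K) (MP (paramsOf d L mT K hL))) × Fin (d + 1) => blockOf (L ^ K) (MP (paramsOf d L mT K hL)) b.1)
    (kingPrV L K r (MP (paramsOf d L mT K hL)))
    (fun k => ((cubeBlocks (MP (paramsOf d L mT K hL)) (coverCorner (MP (paramsOf d L mT K hL)) (L ^ s) (L ^ (mT - s)) (coverMargin L s) k) (L ^ (s + 1)) : Finset _) : Set _))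
    (Δ := deltaOp (MP (paramsOf d L mT K hL)) (L ^ K) a) (Δ' := deltaOp (MP (paramsOf d L mT K hL)) (L ^ r * L ^ K) a)
    (h := knitHR d L s mT K (L ^ K) hL) (h' := knitHR d L s mT K (L ^ r * L ^ K) hL)
    (G := fun k => mulOp (chiCube (MP (paramsOf d L mT K hL)) (L ^ K) (coverCorner (MP (paramsOf d L mT K hL)) (L ^ s) (L ^ (mT - s)) (coverMargin L s) k) (L ^ (s + 1))) ∘ₗ
      knitGR d L s mT K (L ^ K) hL hs a k)
    (G' := fun k => mulOp (chiCube (MP (paramsOf d L mT K hL)) (L ^ r * L ^ K) (coverCorner (MP (paramsOf d L mT K hL)) (L ^ s) (L ^ (mT - s)) (coverMargin L s) k) (L ^ (s + 1))) ∘ₗ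
      knitGR d L s mT K (L ^ r * L ^ K) hL hs a k)
    (θ₀ := Θ₀ / (L : ℝ) ^ s)
    (r := ((Fintype.card (Fin (d + 1)) : ℝ) * (3 * (C *
        (((((L ^ s : ℕ) : ℝ)))⁻¹ ^ 2 * (((L ^ K : ℕ) : ℝ) * ((L ^ s : ℕ) : ℝ))⁻¹ * (144 * π ^ 3 + 32 * π ^ 3 * Fintype.card (Fin (d + 1)))) +
          mc * ((L ^ K : ℕ) : ℝ) ^ (-(1 / 8 / 2 : ℝ)) * (32 * π ^ 2 / ((L ^ s : ℕ) : ℝ) ^ 2)) +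
        2 * ((βp + βb) * (|((((L ^ s : ℕ) : ℝ)))⁻¹| * (((L ^ K : ℕ) : ℝ) * ((L ^ s : ℕ) : ℝ))⁻¹ * (64 * π ^ 2 + π ^ 2 * Fintype.card (Fin (d + 1)))) +
          (mp + mb) * ((L ^ K : ℕ) : ℝ) ^ (-(1 / (8 * ((d : ℝ) + 1)))) * (π / ((L ^ s : ℕ) : ℝ)))) + 0 + rN * ((L : ℝ) ^ K) ^ (-γN)))
    hθK (by positivity) (by positivity) hh' hfitH hN (fun k => (hKD k).1) (fun k => by have h2 := (hKD k).2; rw [hblk] at h2; exact h2)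
  have eC : remainderL (deltaOp (MP (paramsOf d L mT K hL)) (L ^ K) a) (knitHR d L s mT K (L ^ K) hL) (knitGR d L s mT K (L ^ K) hL hs a) =
      remainderL (deltaOp (MP (paramsOf d L mT K hL)) (L ^ K) a) (knitHR d L s mT K (L ^ K) hL)
        (fun k => mulOp (chiCube (MP (paramsOf d L mT K hL)) (L ^ K) (coverCorner (MP (paramsOf d L mT K hL)) (L ^ s) (L ^ (mT - s)) (coverMargin L s) k) (L ^ (s + 1))) ∘ₗ
          knitGR d L s mT K (L ^ K) hL hs a k) := (remainderL_cut hcut).symm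
  have eF : remainderL (deltaOp (MP (paramsOf d L mT K hL)) (L ^ r * L ^ K) a) (knitHR d L s mT K (L ^ r * L ^ K) hL) (knitGR d L s mT K (L ^ r * L ^ K) hL hs a) =
      remainderL (deltaOp (MP (paramsOf d L mT K hL)) (L ^ r * L ^ K) a) (knitHR d L s mT K (L ^ r * L ^ K) hL)
        (fun k => mulOp (chiCube (MP (paramsOf d L mT K hL)) (L ^ r * L ^ K) (coverCorner (MP (paramsOf d L mT K hL)) (L ^ s) (L ^ (mT - s)) (coverMargin L s) k) (L ^ (s + 1))) ∘ₗ
          knitGR d L s mT K (L ^ r * L ^ K) hL hs a k) := (remainderL_cut hcut').symm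
  erw [eC, eF, hblk]
  refine hIR.mono fun y y' => mul_le_mul_of_nonneg_right ?_ (Real.exp_nonneg _)
  -- the uniform constant
  have ho : π * (d + 1) / (((L ^ K : ℕ) : ℝ) * ((L ^ s : ℕ) : ℝ)) ≤ π * (d + 1) * ((L : ℝ) ^ K) ^ (-γ) := by
    rw [div_eq_mul_inv]; exact mul_le_mul_of_nonneg_left hε₁ (by positivity)
  have key := add_le_add hΘd (mul_le_mul ho hθK' hθK (by positivity))
  refine (mul_le_mul_of_nonneg_left key hNov).trans (le_of_eq ?_)
  ring

end Knit

end Summit.QuantumFields.YangMills.BalabanUVNodes.N15.Gluing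

end
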